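import Literature.AnabelianGeometry.EtaleTheta.Discharge.Sec3Cor38BsFldOfFactorisation
import Literature.AnabelianGeometry.EtaleTheta.TemperedFrobenioidToy
import HarnessLib

/-!
# [EtTh] Corollary 3.8 sub-DAG, row C38-L07b `BsFldOfFactorisation`: an inhabitant of the typed interface at
# which the row FAILS — the universal closure of FROZEN FACT-LIST row F-2819 is false

Mochizuki, *The étale theta function …*, Publ. RIMS **45** (2009), Def. 3.3 (iii) p. 73, Def. 3.6 (i)/(ii)
pp. 76–77, Cor. 3.8 proof p. 81 l.15–19 [cite: MochizukiEtTh2009, Cor 3.8 p.81].  abc-iut cell, block F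
(fact-proving wave), seat abc-iut-f-004, FROZEN FACT-LIST row **F-2819** (`TemperedFrobenioid.BsFldOfFactorisation`).
Companion of `Sec3Cor38BsFldOfFactorisation.lean`, whose criterion `bsFldOfFactorisation_iff_isUnit` says that row
C38-L07b holds at a typed tempered Frobenioid iff every unit of every divisor monoid `Φ(A)` is base-field-theoretic.

Here (pattern of abc-iut-L2-t3's `TemperedFrobenioidToy.lean` and abc-iut-w5-d124's `Sec3Cor38CriterionToy.lean`):
* `Cor38UnitToy.C` — an inhabitant of `DivisorMonoids` / `RealifiedDivisorMonoids` / `TemperedFrobenioid` over the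
  one-object base category and the trivial [FrdI] vocabularies with `Φ₀ = Φ^{ℝ-log} = Φ = ℤ × ℤ_{≥0}` (one prime
  `e = (0,1)` and the NON-TRIVIAL UNIT `t = (1,0)`), `B₀^Λ = ℤ·b₀` with `div(b₀) = e`, `F₀^Λ = B₀^Λ`, and
  `ℝ·Φ₀^cnst := Ker(first coordinate)` — root-closed, containing `div(F₀^Λ)`, and making `Φ^{bs-fld} = ℤ_{≥0}·e`
  monoprime (REAL `IsMonoprime`) with Def. 3.6 (ii)(b) AS TYPED; every non-vocabulary field is discharged;
* `Cor38UnitToy.not_isBaseFieldTheoreticDiv_t` — the unit `t` is NOT base-field-theoretic;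
* **`Cor38UnitToy.not_bsFldOfFactorisation : ¬ C.BsFldOfFactorisation`** — so row C38-L07b fails at `C`
  (`TemperedFrobenioid.not_bsFldOfFactorisation_of_isUnit`): concretely `λ = (1, id, −t, 0)` is a pull-back morphism
  and `φ = (1, id, t, 0)` a pre-step with `Div(id ≫ φ ≫ λ) = 0` base-field-theoretic but `Div(φ) = t` not;
* **`Cor38UnitToy.not_forall_bsFldOfFactorisation`** — the universal closure of the row (over all typed tempered
  Frobenioids, universe level `0`) is FALSE.  The row is therefore admissible AT INSTANCES ONLY: it is a theorem for
  sharp / divisorial `Φ` (`TemperedFrobenioid.bsFldOfFactorisation_of_isSharp`, `_of_isDivisorial`) and for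
  `IsFrobenioid C.toElem` (abc-iut-w5-d124's `bsFldOfFactorisation_of_isFrobenioid`).
The divisor monoid `ℤ × ℤ_{≥0}` is not sharp, hence not divisorial: the typed interface records "divisorial" only
through the stub `VD.IsDivisorialOn`, which is the schema gap this witness exploits (cf. plan/GAP-LEDGER G-w5d124-*).

HONEST FRAMING: a consistency/independence witness about TYPED interfaces; not a tempered Frobenioid of a curve;
refereed pre-IUT material; nothing here bears on [IUTchIII] Cor. 3.12.
-/

noncomputable section

namespace Literature.AnabelianGeometry.EtaleTheta

open CategoryTheory Opposite Literature.AlgebraicGeometry.Frobenioids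

namespace Cor38UnitToy

/-! ### §1 The monoid `ℤ × ℤ_{≥0}`, its unit `t` and prime `e`, and the character "first coordinate" -/

/-- The divisor monoid `ℤ × ℤ_{≥0}` of the witness (multiplicative notation). [cite: MochizukiEtTh2009, Def 3.3 p.73] -/
abbrev M : Type := Multiplicative (ℤ × ℕ)

/-- The non-trivial unit `t = (1, 0)`. [cite: MochizukiEtTh2009, Def 3.3 p.73] -/
def t : M := Multiplicative.ofAdd (1, 0)

/-- Its inverse `t' = (−1, 0)`. [cite: MochizukiEtTh2009, Def 3.3 p.73] -/
def t' : M := Multiplicative.ofAdd (-1, 0)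

/-- The prime `e = (0, 1)`. [cite: MochizukiEtTh2009, Def 3.3 p.73] -/
def e : M := Multiplicative.ofAdd (0, 1)

/-- `t · t' = 0` (additively). [cite: MochizukiEtTh2009, Def 3.3 p.73] -/
theorem t_mul_t' : t * t' = 1 := by
  change Multiplicative.ofAdd (((1 : ℤ), (0 : ℕ)) + (-1, 0)) = Multiplicative.ofAdd (0, 0)
  norm_num

/-- `t' · t = 0` (additively). [cite: MochizukiEtTh2009, Def 3.3 p.73] -/
theorem t'_mul_t : t' * t = 1 := by rw [mul_comm, t_mul_t']

/-- The character "first coordinate" `ℤ × ℤ_{≥0} → ℤ`. [cite: MochizukiEtTh2009, Def 3.6 p.76] -/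
def χ : M →* Multiplicative ℤ := (AddMonoidHom.fst ℤ ℕ).toMultiplicative

/-- `χ` on a coordinate vector. [cite: MochizukiEtTh2009, Def 3.6 p.76] -/
theorem χ_apply (f : M) : χ f = Multiplicative.ofAdd (Multiplicative.toAdd f).1 := rfl

/-- The character on the groupification `(ℤ × ℤ_{≥0})^gp → ℤ`. [cite: MochizukiEtTh2009, Def 3.6 p.76] -/
def ψ : Algebra.GrothendieckGroup M →* Multiplicative ℤ := Algebra.GrothendieckGroup.lift χ

/-- `ψ` extends `χ`. [cite: MochizukiEtTh2009, Def 3.6 p.76] -/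
theorem ψ_of (f : M) : ψ (Algebra.GrothendieckGroup.of f) = χ f := by
  have h := Algebra.GrothendieckGroup.lift.symm_apply_apply χ
  rw [Algebra.GrothendieckGroup.lift_symm_apply] at h
  exact DFunLike.congr_fun h f

/-- `div : ℤ → (ℤ × ℤ_{≥0})^gp`, `n ↦ n·e`. [cite: MochizukiEtTh2009, Def 3.3 p.73] -/
def divHom : Multiplicative ℤ →* Algebra.GrothendieckGroup M := zpowersHom _ (Algebra.GrothendieckGroup.of e)

/-- `divHom 1 = e`. [cite: MochizukiEtTh2009, Def 3.3 p.73] -/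
theorem divHom_ofAdd_one : divHom (Multiplicative.ofAdd 1) = Algebra.GrothendieckGroup.of e := by
  rw [divHom, zpowersHom_apply, toAdd_ofAdd, zpow_one]

/-- Every divisor of a "rational function" lies on the line `ψ = 0`. [cite: MochizukiEtTh2009, Def 3.6 p.76] -/
theorem ψ_divHom (b : Multiplicative ℤ) : ψ (divHom b) = 1 := by
  rw [divHom, zpowersHom_apply, map_zpow, ψ_of, χ_apply]
  simp [e]

/-- `gpMap id = id`, pointwise. [folklore] -/
private theorem gpMap_id_apply {N : Type} [CommMonoid N] (x : Algebra.GrothendieckGroup N) :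
    gpMap (MonoidHom.id N) x = x :=
  DFunLike.congr_fun (Literature.AlgebraicGeometry.Frobenioids.gpMap_id (M := N)) x

/-! ### §2 The typed data: Def. 3.3 (iii), Def. 3.6 (i), Def. 3.6 (ii) -/

/-- Def. 3.3 (iii) data of the witness: `Φ₀ = ℤ × ℤ_{≥0}`, `B₀ = ℤ`, `div₀ = (n ↦ n·e)`, `F₀ = B₀`, nothing cuspidal,
over the one-object base category. [cite: MochizukiEtTh2009, Def 3.3 p.73] -/
def divisorMonoids : DivisorMonoids.{0, 0, 0} (Discrete PUnit.{1}) where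
  Φ₀ := (Functor.const _).obj (CommMonCat.of M)
  B₀ := (Functor.const _).obj (CommMonCat.of (Multiplicative ℤ))
  isUnit_B₀ _ b := by
    change IsUnit (M := Multiplicative ℤ) b
    exact Group.isUnit _
  div₀ _ := divHom
  div₀_natural _ b := (gpMap_id_apply (divHom b)).symm
  F₀ _ := ⊤
  F₀_map _ _ _ := trivial
  ncsp₀ _ := ⊤
  csp₀ _ := ⊥
  ncsp₀_map _ _ _ := trivial
  csp₀_map _ x hx := by
    rw [Submonoid.mem_bot] at hx ⊢
    rw [hx, map_one]
  existsUnique_ncsp_csp _ x := by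
    refine ⟨(⟨x, trivial⟩, ⟨1, Submonoid.mem_bot.mpr rfl⟩), mul_one x, ?_⟩
    rintro ⟨a, c⟩ h
    have hc : c.1 = 1 := Submonoid.mem_bot.mp c.2
    have ha : a.1 = x := by
      have h' : a.1 * c.1 = x := h
      rwa [hc, mul_one] at h'
    exact Prod.ext (Subtype.ext ha) (Subtype.ext hc)

/-- Def. 3.6 (i) data of the witness (`Λ = ℤ`, `Φ₀^ℝ = Φ₀`, `B₀^Λ = B₀`, `F₀^Λ = B₀^Λ`) with
`ℝ·Φ₀^cnst := Ker(ψ) = {first coordinate = 0}` — a root-closed subgroup containing `div(F₀^Λ) = ℤ·e` and the image of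
`Φ₀^cnst`, as the typed fields demand, but NOT the unit `t`. [cite: MochizukiEtTh2009, Def 3.6 p.76] -/
def realified : RealifiedDivisorMonoids (D₀ := Discrete PUnit.{1}) Toy.monoidVocab where
  toDivisorMonoids := divisorMonoids
  Λ := MonoidType.Z
  ΦR := (Functor.const _).obj (CommMonCat.of M)
  toR _ := MonoidHom.id _
  toR_natural _ _ := rfl
  isRealification _ := trivial
  BΛ := (Functor.const _).obj (CommMonCat.of (Multiplicative ℤ))
  isUnit_BΛ _ b := by
    change IsUnit (M := Multiplicative ℤ) b
    exact Group.isUnit _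
  divΛ _ := divHom
  divΛ_natural _ b := (gpMap_id_apply (divHom b)).symm
  FΛ _ := ⊤
  FΛ_map _ _ _ := trivial
  cnstR _ := ψ.ker
  cnstR_map _ x hx := by
    show ψ (gpMap (MonoidHom.id M) x) = 1
    rw [gpMap_id_apply]
    exact hx
  divΛ_mem_cnstR _ b _ := by
    show ψ (divHom b) = 1
    exact ψ_divHom b
  cnstR_root _ g n hg := by
    have hg' : ψ g ^ (n : ℕ) = 1 := by rw [← map_pow]; exact hg
    have h : (n : ℕ) • Multiplicative.toAdd (ψ g) = 0 := by
      have := congrArg Multiplicative.toAdd hg'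
      rwa [toAdd_pow, toAdd_one] at this
    show ψ g = 1
    rcases smul_eq_zero.mp h with h | h
    · exact absurd h n.ne_zero
    · exact congrArg Multiplicative.ofAdd h
  cnst_le_cnstR _ b _ := by
    show ψ (gpMap (MonoidHom.id M) (divHom b)) = 1
    rw [gpMap_id_apply]
    exact ψ_divHom b
  ncspR _ := ⊤
  cspR _ := ⊥
  toR_ncsp _ _ _ := trivial
  toR_csp _ _ hx := hx

/-- The base-field-theoretic submonoid `{first coordinate = 0}` of `ℤ × ℤ_{≥0}` is `ℤ_{≥0}·e ≅ ℤ_{≥0}`: the isomorphism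
"second coordinate". [cite: MochizukiEtTh2009, Def 3.6 p.77] -/
def bsFldEquiv :
    ↥((⊤ : Submonoid M) ⊓ (ψ.ker).toSubmonoid.comap Algebra.GrothendieckGroup.of) ≃* Multiplicative ℕ where
  toFun f := Multiplicative.ofAdd (Multiplicative.toAdd f.1).2
  invFun k := ⟨Multiplicative.ofAdd (0, Multiplicative.toAdd k), Submonoid.mem_top _, by
    change ψ (Algebra.GrothendieckGroup.of (Multiplicative.ofAdd ((0 : ℤ), Multiplicative.toAdd k) : M)) = 1
    rw [ψ_of, χ_apply]
    rfl⟩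
  left_inv f := by
    obtain ⟨f, -, hf⟩ := f
    apply Subtype.ext
    change (Multiplicative.ofAdd ((0 : ℤ), (Multiplicative.toAdd f).2) : M) = f
    have hf' : ψ (Algebra.GrothendieckGroup.of f) = 1 := hf
    rw [ψ_of, χ_apply] at hf'
    have h0 : (Multiplicative.toAdd f).1 = 0 := Multiplicative.ofAdd.injective hf'
    change Multiplicative.ofAdd ((0 : ℤ), (Multiplicative.toAdd f).2) = Multiplicative.ofAdd (Multiplicative.toAdd f)
    rw [← h0]
  right_inv k := by simp
  map_mul' f g := by
    change Multiplicative.ofAdd (Multiplicative.toAdd (f.1 * g.1)).2 = _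
    rw [toAdd_mul, Prod.snd_add, ofAdd_add]

/-- `e ≠ 0` in `ℤ × ℤ_{≥0}`. [cite: MochizukiEtTh2009, Def 3.6 p.77] -/
theorem e_ne_one : e ≠ 1 := by
  intro h
  have := congrArg (fun f : M => (Multiplicative.toAdd f).2) h
  simp [e] at this

/-- **The typed tempered-Frobenioid interface is satisfied** by the witness: `D = D₀` one object,
`Φ = Φ^{ℝ-log} = ℤ × ℤ_{≥0}` (group-saturated), `Φ^{bs-fld} ≅ ℤ_{≥0}` monoprime (REAL `IsMonoprime`), and Def. 3.6 (ii)(b)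
AS TYPED: the constant `b₀` has the nonzero divisor `e = e/1` with `e ≠ 1 ∈ Φ`. [cite: MochizukiEtTh2009, Def 3.6 p.77] -/
def C : TemperedFrobenioid realified (Discrete PUnit.{1}) Toy.catVocab where
  isConnected := zigzag_isConnected fun j₁ j₂ => by rw [Subsingleton.elim j₁ j₂]
  isTotallyEpimorphic := ⟨fun f => ⟨fun _ _ _ => Subsingleton.elim _ _⟩⟩
  base := 𝟭 _
  Φ := ⟨fun _ => ⊤, fun _ _ _ => trivial⟩
  isGroupSaturated A := (isGroupSaturated_iff' _).2 fun _ _ _ _ _ _ => trivial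
  isPerfFactorial _ := trivial
  isDivisorialOn := trivial
  isMonoprime_bsFld _ := IsMonoprime.ofZ ⟨⟨bsFldEquiv⟩⟩
  exists_FΛ_div_ne _ := ⟨(Multiplicative.ofAdd (1 : ℤ) : Multiplicative ℤ), trivial, e, trivial, 1, trivial,
    e_ne_one, divHom_ofAdd_one.trans (by
      change Algebra.GrothendieckGroup.of (M := M) e =
        Algebra.GrothendieckGroup.of (M := M) e / Algebra.GrothendieckGroup.of (M := M) 1
      rw [map_one, div_one])⟩

/-! ### §3 The unit `t` of `Φ(pt)` is not base-field-theoretic; row C38-L07b fails at `C` -/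

/-- The one object of the base category. [cite: MochizukiEtTh2009, Def 3.6 p.77] -/
abbrev pt : Discrete PUnit.{1} := ⟨PUnit.unit⟩

/-- The unit `t = (1, 0)` of the divisor monoid `Φ(pt) = ℤ × ℤ_{≥0}` of `C`, with inverse `t' = (−1, 0)`.
[cite: MochizukiEtTh2009, Def 3.6 p.77] -/
def tUnit : (C.divisorMonoid.obj (op pt))ˣ where
  val := ⟨t, trivial⟩
  inv := ⟨t', trivial⟩
  val_inv := Subtype.ext t_mul_t'
  inv_val := Subtype.ext t'_mul_t

/-- `t ∉ Φ^{bs-fld}(pt)`: its first coordinate is `1 ≠ 0`. [cite: MochizukiEtTh2009, Def 3.6 p.78] -/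
theorem not_isBaseFieldTheoreticDiv_t : ¬ C.IsBaseFieldTheoreticDiv (tUnit : C.divisorMonoid.obj (op pt)) := by
  intro h
  have h2 : ψ (Algebra.GrothendieckGroup.of t) = 1 := h.2
  rw [ψ_of, χ_apply] at h2
  have h3 : (Multiplicative.toAdd t).1 = 0 := Multiplicative.ofAdd.injective h2
  simp [t] at h3

/-- **Row C38-L07b fails at the witness**: `¬ C.BsFldOfFactorisation` (the criterion
`TemperedFrobenioid.bsFldOfFactorisation_iff_isUnit` at the unit `t ∉ Φ^{bs-fld}`; explicitly, `λ = (1, id, −t, 0)` is a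
pull-back morphism, `φ = (1, id, t, 0)` a pre-step, `Div(id ≫ φ ≫ λ) = 0` is base-field-theoretic and `Div(φ) = t` is
not). [cite: MochizukiEtTh2009, Cor 3.8 p.81] -/
theorem not_bsFldOfFactorisation : ¬ C.BsFldOfFactorisation :=
  C.not_bsFldOfFactorisation_of_isUnit (tUnit : C.divisorMonoid.obj (op pt)) tUnit.isUnit
    not_isBaseFieldTheoreticDiv_t

/-- **F-2819: the universal closure of row C38-L07b over the typed tempered-Frobenioid interface is FALSE**
(at universe level `0`, where the witness lives): the FROZEN FACT-LIST row `TemperedFrobenioid.BsFldOfFactorisation`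
is admissible AT NAMED INSTANCES ONLY (plan/FACT-LIST.md R5) — instance forms:
`TemperedFrobenioid.bsFldOfFactorisation_of_isSharp` / `_of_isDivisorial` / `bsFldOfFactorisation_of_isFrobenioid`.
[cite: MochizukiEtTh2009, Cor 3.8 p.81] -/
theorem not_forall_bsFldOfFactorisation :
    ¬ ∀ (D₀ : Type) [Category.{0} D₀] (V : FrdIMonoidStub.{0}) (T : RealifiedDivisorMonoids (D₀ := D₀) V)
        (D : Type) [Category.{0} D] (VD : FrdICatStub.{0, 0, 0} D) (C' : TemperedFrobenioid T D VD),
        C'.BsFldOfFactorisation :=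
  fun H => not_bsFldOfFactorisation (H _ _ _ _ _ C)

/-- The interface admits BOTH behaviours: an inhabitant where the row holds (abc-iut-L2-t3's one-prime toy, `Φ = ℤ_{≥0}`
sharp) and one where it fails (`C`).  Row C38-L07b is thus INDEPENDENT of the typed Def. 3.3/3.6 interface.
[cite: MochizukiEtTh2009, Cor 3.8 p.81] -/
theorem bsFldOfFactorisation_independent :
    Toy.temperedFrobenioid.BsFldOfFactorisation ∧ ¬ C.BsFldOfFactorisation := by
  refine ⟨Toy.temperedFrobenioid.bsFldOfFactorisation_of_isSharp fun A => ⟨fun a ha => ?_⟩,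
    not_bsFldOfFactorisation⟩
  -- `Φ(A) = ℤ_{≥0}` (abc-iut-L2-t3's toy) has no unit but `0`
  obtain ⟨b, hb⟩ := ha.exists_right_inv
  have h : (Multiplicative.toAdd : Multiplicative ℕ ≃ ℕ) a.1 + (Multiplicative.toAdd : Multiplicative ℕ ≃ ℕ) b.1 = 0 :=
    congrArg (fun x : Toy.temperedFrobenioid.Φ.carrier A => (Multiplicative.toAdd : Multiplicative ℕ ≃ ℕ) x.1) hb
  exact Subtype.ext (show (a.1 : Multiplicative ℕ) = (Multiplicative.ofAdd : ℕ ≃ Multiplicative ℕ) 0 from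
    congrArg (Multiplicative.ofAdd : ℕ ≃ Multiplicative ℕ) (Nat.eq_zero_of_add_eq_zero_right h))

end Cor38UnitToy

end Literature.AnabelianGeometry.EtaleTheta

end
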